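import Summits.Ventures.CertifiedManyBodySolver.Observables.StiffnessApexTransportAnyDensity
import Literature.MathematicalPhysics.QuantumLattice.HubbardTTPrimeApexRowDoped
import Literature.MathematicalPhysics.QuantumLattice.HubbardTTPrimeDiagHopTransport
import HarnessLib

/-!
# Ventures/CertifiedManyBodySolver — Observables/StiffnessApexTransportDoped.lean

HONEST FRAMING: one-sided certified CEILINGS on the uniform flux stiffness (t–t′ f-sum class) at ANY density, transported across the
`(t′, U)` plane (and the filling interval) by the apex rule; every leaf is CONDITIONAL on the source rows it names; a ceiling never
speaks to the presence of order; not a `T_c` estimate, not a superconductivity verdict. Zero compute, no definition, no claim node.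

Cell `pub/hubbard-downfold` (D-0150 L-DF2 «box ↦ one word»), seat `hubbard-downfold-unc-2` (`prover-hubbard-downfold-unc-2-g14-0`), the
DOPED-BOX edition of the U-interior instrument of record (`StiffnessApexTransport` §4: ONE station covers the slab above it). Away from
half filling the sign `t′K₂ ≤ 0` is gone (the free Fermi sea at `(7/8, −1/4)` has `t′K₂ > 0`); the companion
`StiffnessApexTransportAnyDensity` replaced it by a total-kinetic floor at the source (docc cap × `U`: content-free today). THIS file
replaces it by a FLOOR `B ≤ K₂` on the source class (`Literature/…/HubbardTTPrimeApexRowDoped` §3): the source's own f-sum word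
transports to the target `P` on its apex segment at the exact price `(t′_P − s)·(−B)/2`, and on the station box `[p,q] × [U_A,U_max]`
the lever is at most `|p|(1 − U_A/U_max)` — `≈ 0.035` on a cuprate box one `U`-unit tall — so the doped box is ONE-STATION too:

* §1 leaf at `P` from the source's f-sum orbit row + a `K₂` floor on the source class (`…_of_le_diagHop`); the floor supplied by the
  MIRROR window (cap at the source, energy floor at its `t′ ↦ −t′` mirror; `…_mirror`) or by NOTHING (`|K₂| ≤ 16/π²`, `…_kinematic`,
  price `0.8105695·(t′_P − s)`);
* §2 station ⇒ point and station ⇒ BOX at any density (`…_on_box_of_forall_apexStation_orbitLower_of_le_diagHop`: box word = worst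
  source word `+ |p|(1 − U_A/U_max)(−B)/2`), the two-chord (boxdual bundle) form, the floor taken from ONE «min K₂» word at the inner
  bottom corner (a floor word moves LEFT along `t′`, `HubbardTTPrimeDiagHopTransport` §1), and the hypothesis-free kinematic edition
  (price `0.8105695·|p|(1 − U_A/U_max)`);
* §3 the 3-D box: the same with the filling interval `[n₁, n₂]` (families indexed by the density; the shape `Downfold/StiffnessSeam`'s
  `holdsOn_stiffnessSeqCeilingAt_of_cell` consumes);
* §4 ONE point source words a 2-D REGION at any density given a `K₂` floor on the target class too (dual-free insurance);
* §5 arithmetic: cuprate-box lever `(3/10)(1 − (15/2)/(17/2)) = 3/85`, kinematic box price `< 0.0286084`; along A0's apex curve the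
  hypothesis-free reading at `(10, 7/8, −5/24)` is `0.3603604 + 0.8105695/24 < 0.3941342` — below the total-kinetic route's `0.4008246`.

NOT said: nothing flows toward smaller `U`; the `K₂` floor is an INPUT (certified «min K₂diag» row, mirror window, or kinematics) —
its size sets the price; `λ ≠ 0` words are not of this form; no number of record is produced here.

References: T. Koma, H. Tasaki, J. Stat. Phys. 76 (1994) 745, §1 [KomaTasaki1994]; D. J. Scalapino, S. R. White, S.-C. Zhang, PRB 47
(1993) 7995, §II [ScalapinoWhiteZhang1993]; E. H. Lieb, M. Loss, Duke Math. J. 71 (1993) 337, §8 [LiebLoss1993].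
-/

noncomputable section

namespace Summit.Ventures.CertifiedManyBodySolver.Observables

open Literature.MathematicalPhysics.QuantumLattice
open Literature.MathematicalPhysics.QuantumLattice.ThermodynamicLimit
open Literature.MathematicalPhysics.QuantumFieldTheory
open Literature.Probability.LatticeModels
open Matrix Finset Filter Topology HubbardWave0
open scoped Matrix BigOperators ComplexOrder

/-! ## §1 The leaf at the target from the source's f-sum row and a `K₂` floor on the source class -/

section Leaf

variable {t'P UP t'A UA n : ℝ}

/-- **Doped apex leaf, priced by a source `K₂` floor.** `0 ≤ U_A < U_P`, `U_P·t′_A = (2U_P − U_A)·t′_P`, `t′_A ≤ t′_P`, `0 ≤ n < 2`. The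
source class at `(t′_A, U_A, n)` carries its f-sum orbit row `r ≤ |D₄|⁻¹Σ_γ Re ω_γ(−X₀(t′_A))` under the cap `e₀ ≤ u` (certified, `hu`) and a
floor `B ≤ K₂(ω)`; then `ObsStiffnessSeqCeilingAt t′_P U_P n c` for every `c ≥ −r − (t′_P − t′_A)·B/2`. At `B = 0` this is
`…_of_apexSource_fsumRow_of_diagHop_sign`. [cite: KomaTasaki1994, §1] [cite: ScalapinoWhiteZhang1993, §II] -/
theorem ObsStiffnessSeqCeilingAt_of_apexSource_fsumRow_of_le_diagHop (Uo : ℝ) (hUA : 0 ≤ UA) (hU : UA < UP)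
    (hapex : UP * t'A = (2 * UP - UA) * t'P) (ht : t'A ≤ t'P) (hn0 : 0 ≤ n) (hn2 : n < 2) {u r : ℚ}
    (hrow : SquareTTPrimeCorrOrbitLowerRow t'A UA n u r Finset.univ (box 2 7) (-oddMomentObsTT t'A Uo 0))
    (hu : energyDensityTT' 1 t'A UA n ≤ ((u : ℚ) : ℝ)) {B : ℝ}
    (hB : ∀ (ω : InfVolFermionState 2) (Ls : ℕ → ℕ) (ψ : ∀ L, Fock (Orb (FermionTorus 2 L))),
      Tendsto Ls atTop atTop →
      (∀ j, IsGroundStateInSector (hubbardTorusTT' (Ls j) 1 t'A UA) (rectN n (Ls j)) 0 (ψ (Ls j))) →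
      (∀ j, star (ψ (Ls j)) ⬝ᵥ ψ (Ls j) = 1) → ω.IsTorusLimitOf ψ Ls →
      B ≤ ω.meanEnergy (hubbardTTPrimeFermionInteraction 0 1 0) 1)
    (c : ℚ) (hc : -((r : ℚ) : ℝ) - (t'P - t'A) * B / 2 ≤ ((c : ℚ) : ℝ)) :
    ObsStiffnessSeqCeilingAt t'P UP n c := by
  refine ObsStiffnessSeqCeilingAt_of_forall_apexSource_oneBody_ge hUA hU hapex hn0 hn2
    (ℓ := 4 * ((r : ℚ) : ℝ) + 2 * (t'P - t'A) * B) (fun ω Ls ψ hLs hψ h1 hω => ?_) c (by linarith)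
  have h := hrow ω Ls ψ hLs hψ h1 hω hu
  rw [orbitMean_re_expect_neg_oddMomentTT_lam_zero hω.isTranslationInvariant] at h
  have hcmp := InfVolFermionState.meanEnergy_hopping_add_mul_le_of_le_diagHop ω 1 (κ := 2 * t'A) (κ' := 2 * t'P)
    (by linarith) (hB ω Ls ψ hLs hψ h1 hω)
  have e : (2 * t'P - 2 * t'A) * B = 2 * (t'P - t'A) * B := by ring
  linarith

/-- **Doped apex leaf, MIRROR edition (`t′_A < 0`; energy rows only).** Same geometry; the `K₂` floor is supplied by the cap `u` at
the source and a certified floor `l ≤ e₀(1, −t′_A, U_A, n)` at its mirror (`(u − l)/(2t′_A) ≤ K₂`, `HubbardTTPrimeApexRowDoped` §1;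
`e₀(1,−t′_A,U_A,n) = e₀(1,t′_A,U_A,2−n) + U_A(n−1)` if an electron-doped floor is what exists): `c ≥ −r − (t′_P − t′_A)·((u − l)/(2t′_A))/2`.
[cite: KomaTasaki1994, §1] [cite: ScalapinoWhiteZhang1993, §II] -/
theorem ObsStiffnessSeqCeilingAt_of_apexSource_fsumRow_mirror (Uo : ℝ) (hUA : 0 ≤ UA) (hU : UA < UP)
    (hapex : UP * t'A = (2 * UP - UA) * t'P) (ht'A : t'A < 0) (ht : t'A ≤ t'P) (hn0 : 0 ≤ n) (hn2 : n < 2)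
    {u r : ℚ} (hrow : SquareTTPrimeCorrOrbitLowerRow t'A UA n u r Finset.univ (box 2 7) (-oddMomentObsTT t'A Uo 0))
    (hu : energyDensityTT' 1 t'A UA n ≤ ((u : ℚ) : ℝ)) {l : ℝ} (hl : l ≤ energyDensityTT' 1 (-t'A) UA n) (c : ℚ)
    (hc : -((r : ℚ) : ℝ) - (t'P - t'A) * ((((u : ℚ) : ℝ) - l) / (2 * t'A)) / 2 ≤ ((c : ℚ) : ℝ)) :
    ObsStiffnessSeqCeilingAt t'P UP n c :=
  ObsStiffnessSeqCeilingAt_of_apexSource_fsumRow_of_le_diagHop Uo hUA hU hapex ht hn0 hn2 hrow hu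
    (fun _ω _Ls _ψ hLs hψ h1 hω =>
      InfVolFermionState.IsTorusLimitOf.div_le_diagHop_of_mirror_window_of_neg 1 ht'A hUA hn0 hn2 hu hl hω hLs hψ h1)
    c hc

/-- **Doped apex leaf, KINEMATIC edition (no `K₂` input at all).** Same geometry; `−16/π² ≤ K₂` on every class prices the
transport by `0.8105695·(t′_P − t′_A)` (the engine's decimal row `|K₂| ≤ 1.6211390`, `IsTorusLimitOf.abs_meanEnergy_diagHop_le_decimal`): `c ≥ −r + 0.8105695·(t′_P − t′_A)` suffices. [cite: LiebLoss1993, §8, Theorem 8.2] [cite: ScalapinoWhiteZhang1993, §II] -/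
theorem ObsStiffnessSeqCeilingAt_of_apexSource_fsumRow_kinematic (Uo : ℝ) (hUA : 0 ≤ UA) (hU : UA < UP)
    (hapex : UP * t'A = (2 * UP - UA) * t'P) (ht : t'A ≤ t'P) (hn0 : 0 ≤ n) (hn2 : n < 2) {u r : ℚ}
    (hrow : SquareTTPrimeCorrOrbitLowerRow t'A UA n u r Finset.univ (box 2 7) (-oddMomentObsTT t'A Uo 0))
    (hu : energyDensityTT' 1 t'A UA n ≤ ((u : ℚ) : ℝ)) (c : ℚ)
    (hc : -((r : ℚ) : ℝ) + 0.8105695 * (t'P - t'A) ≤ ((c : ℚ) : ℝ)) :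
    ObsStiffnessSeqCeilingAt t'P UP n c := by
  refine ObsStiffnessSeqCeilingAt_of_apexSource_fsumRow_of_le_diagHop Uo hUA hU hapex ht hn0 hn2 hrow hu
    (B := -(1.6211390 : ℝ)) (fun ω Ls ψ hLs hψ h1 hω => ?_) c (by linarith)
  have hN : ∀ j, IsNParticle (rectN n (Ls j)) (ψ (Ls j)) := fun j => ((mem_szSector_iff _ _ _).1 (hψ j).1).1
  exact (abs_le.1 (hω.abs_meanEnergy_diagHop_le_decimal hn0 hn2 hLs hN h1)).1

end Leaf

/-! ## §2 The station instrument at any density: one source segment at `U_A` covers the slab above it, priced -/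

/-- The lever of a box point: for `0 < U_A ≤ U ≤ U_max` and `p ≤ t′ ≤ 0`, the gap between the target hopping `t′` and its source
parameter `t′(2U − U_A)/U` is `(−t′)(1 − U_A/U) ∈ [0, (−p)(1 − U_A/U_max)]`. [cite: KomaTasaki1994, §1] -/
theorem apexLever_mem_Icc_of_slab {UA Umax p tp U : ℝ} (hUA : 0 < UA) (hU : UA ≤ U) (hUmax : U ≤ Umax) (hp : p ≤ tp)
    (htp : tp ≤ 0) : tp - tp * (2 * U - UA) / U ∈ Set.Icc 0 ((-p) * (1 - UA / Umax)) := by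
  have hU0 : 0 < U := hUA.trans_le hU
  have e : tp - tp * (2 * U - UA) / U = (-tp) * (1 - UA / U) := by field_simp; ring
  rw [e]
  have hf0 : 0 ≤ 1 - UA / U := by have : UA / U ≤ 1 := (div_le_one hU0).2 hU; linarith
  have hf : 1 - UA / U ≤ 1 - UA / Umax := by
    have : UA / Umax ≤ UA / U := div_le_div_of_nonneg_left hUA.le hU0 hUmax; linarith
  exact ⟨mul_nonneg (by linarith) hf0, mul_le_mul (by linarith) hf hf0 (by linarith)⟩

section Station

variable {UA a b n : ℝ}

/-- **Station ⇒ point, any density.** Station `U_A ≥ 0`, density `0 ≤ n < 2`; an unconditional orbit-lower family `val` for the f-sum word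
on the source segment `s ∈ [a, b]` (torus-limit ground states of `hubbardTorusTT' L 1 s U_A` at density `n`) and a floor `B ≤ K₂(ω)` on the
same classes. Then for every target `(t′_P, U_P)`, `U_A ≤ U_P`, `0 < U_P`, `t′_P ≤ 0`, with source parameter `s⋆ = t′_P(2U_P − U_A)/U_P ∈ [a, b]`:
`ObsStiffnessSeqCeilingAt t′_P U_P n c` for every `c ≥ −val s⋆ − (t′_P − s⋆)·B/2`. [cite: KomaTasaki1994, §1] [cite: ScalapinoWhiteZhang1993, §II] -/
theorem ObsStiffnessSeqCeilingAt_of_forall_apexStation_orbitLower_of_le_diagHop (hUA : 0 ≤ UA) (hn0 : 0 ≤ n) (hn2 : n < 2)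
    (val : ℝ → ℝ) {B : ℝ} (c : ℚ)
    (h : ∀ s ∈ Set.Icc a b, ∀ (ω : InfVolFermionState 2) (Ls : ℕ → ℕ) (ψ : ∀ L, Fock (Orb (FermionTorus 2 L))),
      Tendsto Ls atTop atTop →
      (∀ j, IsGroundStateInSector (hubbardTorusTT' (Ls j) 1 s UA) (rectN n (Ls j)) 0 (ψ (Ls j))) →
      (∀ j, star (ψ (Ls j)) ⬝ᵥ ψ (Ls j) = 1) → ω.IsTorusLimitOf ψ Ls →
      val s ≤ ((Finset.univ : Finset (DihedralGroup 4)).card : ℝ)⁻¹ * ∑ g ∈ (Finset.univ : Finset (DihedralGroup 4)),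
        (ω.expect (d4ShiftSet g 0 (box 2 7)) (fermionEmbed (PolySite.d4Emb g 0 (box 2 7)) (-oddMomentObsTT s UA 0))).re)
    (hB : ∀ s ∈ Set.Icc a b, ∀ (ω : InfVolFermionState 2) (Ls : ℕ → ℕ) (ψ : ∀ L, Fock (Orb (FermionTorus 2 L))),
      Tendsto Ls atTop atTop →
      (∀ j, IsGroundStateInSector (hubbardTorusTT' (Ls j) 1 s UA) (rectN n (Ls j)) 0 (ψ (Ls j))) →
      (∀ j, star (ψ (Ls j)) ⬝ᵥ ψ (Ls j) = 1) → ω.IsTorusLimitOf ψ Ls →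
      B ≤ ω.meanEnergy (hubbardTTPrimeFermionInteraction 0 1 0) 1)
    {t'P UP : ℝ} (hU : UA ≤ UP) (hUP : 0 < UP) (ht'P : t'P ≤ 0) (hs : t'P * (2 * UP - UA) / UP ∈ Set.Icc a b)
    (hc : -val (t'P * (2 * UP - UA) / UP) - (t'P - t'P * (2 * UP - UA) / UP) * B / 2 ≤ ((c : ℚ) : ℝ)) :
    ObsStiffnessSeqCeilingAt t'P UP n c := by
  intro ρs θ₀ _ hθ₀ Ls hLs hst
  refine fluxStiffness_le_of_torusLimitTT'_oddMoment_orbit_certificate_seq t'P (U := UP) (δ := 1 - n) (q := ((c : ℚ) : ℝ)) 0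
    Finset.univ Finset.univ_nonempty (by linarith) (by linarith) hθ₀ hLs hst ?_
  intro ω Ms ψ hMs hψ h1 hω
  have hψ' : ∀ j, IsGroundStateInSector (hubbardTorusTT' (Ms j) 1 t'P UP) (rectN n (Ms j)) 0 (ψ (Ms j)) := fun j => by
    simpa only [sub_sub_cancel] using hψ j
  rw [orbitMean_rotOddMomentLimitFunctionalTT_lam_zero_eq_meanEnergy_twice_tPrime hω.isTranslationInvariant]
  rcases hU.eq_or_lt with heq | hlt
  · -- the station IS the target coupling
    subst heq
    have hs1 : t'P * (2 * UA - UA) / UA = t'P := by field_simp; ring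
    rw [hs1] at hs hc
    have hv := h t'P hs ω Ms ψ hMs hψ' h1 hω
    rw [orbitMean_re_expect_neg_oddMomentTT_lam_zero hω.isTranslationInvariant] at hv
    have e0 : (t'P - t'P) * B / 2 = 0 := by ring
    linarith
  · -- genuine transport from an inhabitant of the source class at the station, priced by its `K₂` floor
    set s : ℝ := t'P * (2 * UP - UA) / UP with hs_def
    have hapex : UP * s = (2 * UP - UA) * t'P := by rw [hs_def]; field_simp
    have hst : s ≤ t'P := by
      have e : s = t'P + t'P * ((UP - UA) / UP) := by rw [hs_def]; field_simp; ring
      have hf : 0 ≤ (UP - UA) / UP := div_nonneg (by linarith) hUP.le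
      have hm : t'P * ((UP - UA) / UP) ≤ 0 := mul_nonpos_iff.2 (Or.inr ⟨ht'P, hf⟩)
      rw [e]; linarith
    obtain ⟨ψA, φ, ωA, hφ, hψA, hψA1, hωA, -, -, -⟩ :=
      exists_isTorusLimitOf_sectorGroundState_TT' 1 s UA hn0 hn2.le (Ls := id) tendsto_id
    have hLφ : Tendsto (id ∘ φ : ℕ → ℕ) atTop atTop := tendsto_id.comp hφ.tendsto_atTop
    have hBω := hB s hs ωA (id ∘ φ) ψA hLφ (fun j => hψA _) (fun j => hψA1 _) hωA
    have hapx := InfVolFermionState.IsTorusLimitOf.meanEnergy_twice_tPrime_source_add_le_of_groundStates_apex 1 s t'P hUA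
      hlt hapex hst hn0 hn2 hωA hLφ (fun j => hψA _) (fun j => hψA1 _) hω hMs hψ' h1 hBω
    have hv := h s hs ωA (id ∘ φ) ψA hLφ (fun j => hψA _) (fun j => hψA1 _) hωA
    rw [orbitMean_re_expect_neg_oddMomentTT_lam_zero hωA.isTranslationInvariant] at hv
    linarith

end Station

section Box

variable {UA Umax p q n : ℝ}

/-- **THE DOPED BOX FROM ONE STATION.** `0 < U_A`, targets `t′ ∈ [p, q]` (`q ≤ 0`), `U ∈ [U_A, U_max]`, density `0 ≤ n < 2`. On the source
segment `s ∈ [p(2 − U_A/U_max), q]` at the station: an unconditional f-sum orbit-lower family `val` and a floor `B ≤ K₂(ω)` (`B ≤ 0`). Then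
`ObsStiffnessSeqCeilingAt t′ U n c` at EVERY point of the box for every `c` with `−val s + (−p)(1 − U_A/U_max)(−B)/2 ≤ c` on the segment:
box word = worst source word + a price whose lever `(−p)(1 − U_A/U_max)` is `3/85 ≈ 0.035` on `[−3/10,−1/5] × [15/2,17/2]`.
[cite: KomaTasaki1994, §1] [cite: ScalapinoWhiteZhang1993, §II] -/
theorem ObsStiffnessSeqCeilingAt_on_box_of_forall_apexStation_orbitLower_of_le_diagHop (hUA : 0 < UA) (hq : q ≤ 0)
    (hn0 : 0 ≤ n) (hn2 : n < 2) (val : ℝ → ℝ) {B : ℝ} (hB0 : B ≤ 0) (c : ℚ)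
    (h : ∀ s ∈ Set.Icc (p * (2 - UA / Umax)) q,
      ∀ (ω : InfVolFermionState 2) (Ls : ℕ → ℕ) (ψ : ∀ L, Fock (Orb (FermionTorus 2 L))),
      Tendsto Ls atTop atTop →
      (∀ j, IsGroundStateInSector (hubbardTorusTT' (Ls j) 1 s UA) (rectN n (Ls j)) 0 (ψ (Ls j))) →
      (∀ j, star (ψ (Ls j)) ⬝ᵥ ψ (Ls j) = 1) → ω.IsTorusLimitOf ψ Ls →
      val s ≤ ((Finset.univ : Finset (DihedralGroup 4)).card : ℝ)⁻¹ * ∑ g ∈ (Finset.univ : Finset (DihedralGroup 4)),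
        (ω.expect (d4ShiftSet g 0 (box 2 7)) (fermionEmbed (PolySite.d4Emb g 0 (box 2 7)) (-oddMomentObsTT s UA 0))).re)
    (hB : ∀ s ∈ Set.Icc (p * (2 - UA / Umax)) q,
      ∀ (ω : InfVolFermionState 2) (Ls : ℕ → ℕ) (ψ : ∀ L, Fock (Orb (FermionTorus 2 L))),
      Tendsto Ls atTop atTop →
      (∀ j, IsGroundStateInSector (hubbardTorusTT' (Ls j) 1 s UA) (rectN n (Ls j)) 0 (ψ (Ls j))) →
      (∀ j, star (ψ (Ls j)) ⬝ᵥ ψ (Ls j) = 1) → ω.IsTorusLimitOf ψ Ls →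
      B ≤ ω.meanEnergy (hubbardTTPrimeFermionInteraction 0 1 0) 1)
    (hc : ∀ s ∈ Set.Icc (p * (2 - UA / Umax)) q, -val s + (-p) * (1 - UA / Umax) * (-B) / 2 ≤ ((c : ℚ) : ℝ)) :
    ∀ tp ∈ Set.Icc p q, ∀ U ∈ Set.Icc UA Umax, ObsStiffnessSeqCeilingAt tp U n c := by
  intro tp htp U hU
  have hs := apexSource_mem_Icc_of_slab hUA hU.1 hU.2 hq htp
  have htp0 : tp ≤ 0 := htp.2.trans hq
  refine ObsStiffnessSeqCeilingAt_of_forall_apexStation_orbitLower_of_le_diagHop hUA.le hn0 hn2 val c h hB hU.1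
    (hUA.trans_le hU.1) htp0 hs ?_
  obtain ⟨hl0, hl⟩ := apexLever_mem_Icc_of_slab hUA hU.1 hU.2 htp.1 htp0
  have hc' := hc _ hs
  nlinarith [mul_le_mul_of_nonneg_right hl (neg_nonneg.2 hB0), hl0]

/-- **Two-corner (bundle) form of the doped box theorem.** If the family on the source segment `[s₁, s₂]`, `s₁ = p(2 − U_A/U_max) < s₂ = q ≤ 0`,
is the CHORD `λ₁(s)v₁ + λ₂(s)v₂` of two corner constants (two corner certificates sharing one dual), then `ObsStiffnessSeqCeilingAt tp U n c` on
the whole box for every `c ≥ max(−v₁, −v₂) + (−p)(1 − U_A/U_max)(−B)/2`. [cite: KomaTasaki1994, §1] [cite: ScalapinoWhiteZhang1993, §II] -/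
theorem ObsStiffnessSeqCeilingAt_on_box_of_apexStation_chord_of_le_diagHop (hUA : 0 < UA) (hq : q ≤ 0) (hn0 : 0 ≤ n)
    (hn2 : n < 2) (h12 : p * (2 - UA / Umax) < q) (v₁ v₂ : ℝ) {B : ℝ} (hB0 : B ≤ 0) (c : ℚ)
    (hc₁ : -v₁ + (-p) * (1 - UA / Umax) * (-B) / 2 ≤ ((c : ℚ) : ℝ))
    (hc₂ : -v₂ + (-p) * (1 - UA / Umax) * (-B) / 2 ≤ ((c : ℚ) : ℝ))
    (h : ∀ s ∈ Set.Icc (p * (2 - UA / Umax)) q,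
      ∀ (ω : InfVolFermionState 2) (Ls : ℕ → ℕ) (ψ : ∀ L, Fock (Orb (FermionTorus 2 L))),
      Tendsto Ls atTop atTop →
      (∀ j, IsGroundStateInSector (hubbardTorusTT' (Ls j) 1 s UA) (rectN n (Ls j)) 0 (ψ (Ls j))) →
      (∀ j, star (ψ (Ls j)) ⬝ᵥ ψ (Ls j) = 1) → ω.IsTorusLimitOf ψ Ls →
      (q - s) / (q - p * (2 - UA / Umax)) * v₁ + (s - p * (2 - UA / Umax)) / (q - p * (2 - UA / Umax)) * v₂ ≤
        ((Finset.univ : Finset (DihedralGroup 4)).card : ℝ)⁻¹ * ∑ g ∈ (Finset.univ : Finset (DihedralGroup 4)),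
          (ω.expect (d4ShiftSet g 0 (box 2 7)) (fermionEmbed (PolySite.d4Emb g 0 (box 2 7)) (-oddMomentObsTT s UA 0))).re)
    (hB : ∀ s ∈ Set.Icc (p * (2 - UA / Umax)) q,
      ∀ (ω : InfVolFermionState 2) (Ls : ℕ → ℕ) (ψ : ∀ L, Fock (Orb (FermionTorus 2 L))),
      Tendsto Ls atTop atTop →
      (∀ j, IsGroundStateInSector (hubbardTorusTT' (Ls j) 1 s UA) (rectN n (Ls j)) 0 (ψ (Ls j))) →
      (∀ j, star (ψ (Ls j)) ⬝ᵥ ψ (Ls j) = 1) → ω.IsTorusLimitOf ψ Ls →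
      B ≤ ω.meanEnergy (hubbardTTPrimeFermionInteraction 0 1 0) 1) :
    ∀ tp ∈ Set.Icc p q, ∀ U ∈ Set.Icc UA Umax, ObsStiffnessSeqCeilingAt tp U n c := by
  refine ObsStiffnessSeqCeilingAt_on_box_of_forall_apexStation_orbitLower_of_le_diagHop hUA hq hn0 hn2
    (fun s => (q - s) / (q - p * (2 - UA / Umax)) * v₁ + (s - p * (2 - UA / Umax)) / (q - p * (2 - UA / Umax)) * v₂) hB0 c h hB
    fun s hs => ?_
  obtain ⟨hl₁, hl₂, hsum, -, -⟩ := tPrimeSegment_weights h12 hs.1 hs.2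
  have hmin := min_le_chord_of_weights (c₁ := v₁) (c₂ := v₂) hl₁ hl₂ hsum
  have hneg : -min v₁ v₂ + (-p) * (1 - UA / Umax) * (-B) / 2 ≤ ((c : ℚ) : ℝ) := by
    rcases le_total v₁ v₂ with hv | hv
    · rw [min_eq_left hv]; exact hc₁
    · rw [min_eq_right hv]; exact hc₂
  linarith

/-- **The `K₂` floor from ONE word at the inner bottom corner.** A floor word `B ≤ K₂(ω)` certified for the class at `(q, U_A, n)` (the
right end of the source segment — one «min K₂diag» objective row) is a floor word on the whole segment (`K₂` is antitone in `t′`,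
`IsTorusLimitOf.le_meanEnergy_diagHop_of_forall_right`), so the doped box theorem needs the f-sum family plus that ONE word.
[cite: KomaTasaki1994, §1] [cite: Griffiths1966, §II] -/
theorem ObsStiffnessSeqCeilingAt_on_box_of_forall_apexStation_orbitLower_of_cornerDiagHopFloor (hUA : 0 < UA) (hq : q ≤ 0)
    (hn0 : 0 ≤ n) (hn2 : n < 2) (val : ℝ → ℝ) {B : ℝ} (hB0 : B ≤ 0) (c : ℚ)
    (h : ∀ s ∈ Set.Icc (p * (2 - UA / Umax)) q,
      ∀ (ω : InfVolFermionState 2) (Ls : ℕ → ℕ) (ψ : ∀ L, Fock (Orb (FermionTorus 2 L))),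
      Tendsto Ls atTop atTop →
      (∀ j, IsGroundStateInSector (hubbardTorusTT' (Ls j) 1 s UA) (rectN n (Ls j)) 0 (ψ (Ls j))) →
      (∀ j, star (ψ (Ls j)) ⬝ᵥ ψ (Ls j) = 1) → ω.IsTorusLimitOf ψ Ls →
      val s ≤ ((Finset.univ : Finset (DihedralGroup 4)).card : ℝ)⁻¹ * ∑ g ∈ (Finset.univ : Finset (DihedralGroup 4)),
        (ω.expect (d4ShiftSet g 0 (box 2 7)) (fermionEmbed (PolySite.d4Emb g 0 (box 2 7)) (-oddMomentObsTT s UA 0))).re)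
    (hBq : ∀ (ω : InfVolFermionState 2) (Ls : ℕ → ℕ) (ψ : ∀ L, Fock (Orb (FermionTorus 2 L))),
      Tendsto Ls atTop atTop →
      (∀ j, IsGroundStateInSector (hubbardTorusTT' (Ls j) 1 q UA) (rectN n (Ls j)) 0 (ψ (Ls j))) →
      (∀ j, star (ψ (Ls j)) ⬝ᵥ ψ (Ls j) = 1) → ω.IsTorusLimitOf ψ Ls →
      B ≤ ω.meanEnergy (hubbardTTPrimeFermionInteraction 0 1 0) 1)
    (hc : ∀ s ∈ Set.Icc (p * (2 - UA / Umax)) q, -val s + (-p) * (1 - UA / Umax) * (-B) / 2 ≤ ((c : ℚ) : ℝ)) :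
    ∀ tp ∈ Set.Icc p q, ∀ U ∈ Set.Icc UA Umax, ObsStiffnessSeqCeilingAt tp U n c :=
  ObsStiffnessSeqCeilingAt_on_box_of_forall_apexStation_orbitLower_of_le_diagHop hUA hq hn0 hn2 val hB0 c h
    (fun _s hs _ω _Ls _ψ hLs hψ h1 hω =>
      InfVolFermionState.IsTorusLimitOf.le_meanEnergy_diagHop_of_forall_right 1 hs.2 hUA.le hn0 hn2 hBq hω hLs hψ h1)
    hc

/-- **KINEMATIC edition of the doped box theorem (no `K₂` input).** The f-sum family alone words the whole box for every `c` with
`−val s + 0.8105695·(−p)(1 − U_A/U_max) ≤ c` on the source segment (`−1.6211390 ≤ K₂`, the decimal of `−16/π²`; price `< 0.0286084` on `[−3/10,−1/5] × [15/2,17/2]`, §5).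
[cite: LiebLoss1993, §8, Theorem 8.2] [cite: ScalapinoWhiteZhang1993, §II] -/
theorem ObsStiffnessSeqCeilingAt_on_box_of_forall_apexStation_orbitLower_kinematic (hUA : 0 < UA) (hq : q ≤ 0)
    (hn0 : 0 ≤ n) (hn2 : n < 2) (val : ℝ → ℝ) (c : ℚ)
    (h : ∀ s ∈ Set.Icc (p * (2 - UA / Umax)) q,
      ∀ (ω : InfVolFermionState 2) (Ls : ℕ → ℕ) (ψ : ∀ L, Fock (Orb (FermionTorus 2 L))),
      Tendsto Ls atTop atTop →
      (∀ j, IsGroundStateInSector (hubbardTorusTT' (Ls j) 1 s UA) (rectN n (Ls j)) 0 (ψ (Ls j))) →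
      (∀ j, star (ψ (Ls j)) ⬝ᵥ ψ (Ls j) = 1) → ω.IsTorusLimitOf ψ Ls →
      val s ≤ ((Finset.univ : Finset (DihedralGroup 4)).card : ℝ)⁻¹ * ∑ g ∈ (Finset.univ : Finset (DihedralGroup 4)),
        (ω.expect (d4ShiftSet g 0 (box 2 7)) (fermionEmbed (PolySite.d4Emb g 0 (box 2 7)) (-oddMomentObsTT s UA 0))).re)
    (hc : ∀ s ∈ Set.Icc (p * (2 - UA / Umax)) q, -val s + 0.8105695 * ((-p) * (1 - UA / Umax)) ≤ ((c : ℚ) : ℝ)) :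
    ∀ tp ∈ Set.Icc p q, ∀ U ∈ Set.Icc UA Umax, ObsStiffnessSeqCeilingAt tp U n c := by
  refine ObsStiffnessSeqCeilingAt_on_box_of_forall_apexStation_orbitLower_of_le_diagHop hUA hq hn0 hn2 val
    (B := -(1.6211390 : ℝ)) (by norm_num) c h (fun s _ ω Ls ψ hLs hψ h1 hω => ?_) fun s hs => ?_
  · have hN : ∀ j, IsNParticle (rectN n (Ls j)) (ψ (Ls j)) := fun j => ((mem_szSector_iff _ _ _).1 (hψ j).1).1
    exact (abs_le.1 (hω.abs_meanEnergy_diagHop_le_decimal hn0 hn2 hLs hN h1)).1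
  · have hc' := hc s hs
    have e : (-p) * (1 - UA / Umax) * -(-(1.6211390 : ℝ)) / 2 = 0.8105695 * ((-p) * (1 - UA / Umax)) := by ring
    rw [e]; exact hc'

end Box

/-! ## §3 The 3-D box: the filling interval rides along (families indexed by the density) -/

section Box3

variable {UA Umax p q n₁ n₂ : ℝ}

/-- **THE DOPED 3-D BOX `[p,q] × [U_A,U_max] × [n₁,n₂]` FROM ONE STATION.** For every density `x ∈ [n₁, n₂] ⊆ [0, 2)` an f-sum
orbit-lower family `val x` and a `K₂` floor `B x ≤ 0` on the source segment at the station (e.g. a window certificate read at every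
density, `Rows/DopedTLCorrFilling`), priced as in §2: then `ObsStiffnessSeqCeilingAt t′ U x c` on the whole 3-D box — the hypothesis
shape `Downfold/StiffnessSeam.holdsOn_stiffnessSeqCeilingAt_of_cell` consumes. [cite: KomaTasaki1994, §1] [cite: ScalapinoWhiteZhang1993, §II] -/
theorem ObsStiffnessSeqCeilingAt_on_box3_of_forall_apexStation_orbitLower_of_le_diagHop (hUA : 0 < UA) (hq : q ≤ 0)
    (hn₁ : 0 ≤ n₁) (hn₂ : n₂ < 2) (val : ℝ → ℝ → ℝ) (B : ℝ → ℝ) (hB0 : ∀ x ∈ Set.Icc n₁ n₂, B x ≤ 0) (c : ℚ)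
    (h : ∀ x ∈ Set.Icc n₁ n₂, ∀ s ∈ Set.Icc (p * (2 - UA / Umax)) q,
      ∀ (ω : InfVolFermionState 2) (Ls : ℕ → ℕ) (ψ : ∀ L, Fock (Orb (FermionTorus 2 L))),
      Tendsto Ls atTop atTop →
      (∀ j, IsGroundStateInSector (hubbardTorusTT' (Ls j) 1 s UA) (rectN x (Ls j)) 0 (ψ (Ls j))) →
      (∀ j, star (ψ (Ls j)) ⬝ᵥ ψ (Ls j) = 1) → ω.IsTorusLimitOf ψ Ls →
      val x s ≤ ((Finset.univ : Finset (DihedralGroup 4)).card : ℝ)⁻¹ * ∑ g ∈ (Finset.univ : Finset (DihedralGroup 4)),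
        (ω.expect (d4ShiftSet g 0 (box 2 7)) (fermionEmbed (PolySite.d4Emb g 0 (box 2 7)) (-oddMomentObsTT s UA 0))).re)
    (hB : ∀ x ∈ Set.Icc n₁ n₂, ∀ s ∈ Set.Icc (p * (2 - UA / Umax)) q,
      ∀ (ω : InfVolFermionState 2) (Ls : ℕ → ℕ) (ψ : ∀ L, Fock (Orb (FermionTorus 2 L))),
      Tendsto Ls atTop atTop →
      (∀ j, IsGroundStateInSector (hubbardTorusTT' (Ls j) 1 s UA) (rectN x (Ls j)) 0 (ψ (Ls j))) →
      (∀ j, star (ψ (Ls j)) ⬝ᵥ ψ (Ls j) = 1) → ω.IsTorusLimitOf ψ Ls →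
      B x ≤ ω.meanEnergy (hubbardTTPrimeFermionInteraction 0 1 0) 1)
    (hc : ∀ x ∈ Set.Icc n₁ n₂, ∀ s ∈ Set.Icc (p * (2 - UA / Umax)) q,
      -val x s + (-p) * (1 - UA / Umax) * (-B x) / 2 ≤ ((c : ℚ) : ℝ)) :
    ∀ tp ∈ Set.Icc p q, ∀ U ∈ Set.Icc UA Umax, ∀ x ∈ Set.Icc n₁ n₂, ObsStiffnessSeqCeilingAt tp U x c := by
  intro tp htp U hU x hx
  exact ObsStiffnessSeqCeilingAt_on_box_of_forall_apexStation_orbitLower_of_le_diagHop hUA hq (hn₁.trans hx.1)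
    (hx.2.trans_lt hn₂) (val x) (hB0 x hx) c (h x hx) (hB x hx) (hc x hx) tp htp U hU

end Box3

/-! ## §4 What ONE point source words at any density: the apex REGION, given a `K₂` floor on the target class too -/

section Region

variable {t'A UA n : ℝ}

/-- **One corner row words a 2-D REGION at any density.** A certified f-sum orbit row `r` at `(t′_A, U_A, n)` (`U_A ≥ 0`, cap `u` certified)
with a floor `B_A ≤ K₂` on its class gives `ObsStiffnessSeqCeilingAt t′_P U_P n c` for every target with `U_A < U_P`,
`U_A·t′_P ≤ t′_A·(2U_A − U_P)`, `t′_A·U_P ≤ t′_P·(2U_P − U_A)` (the apex hopping `κ` of the line `AP` lies in `[2t′_A, 2t′_P]`) whose class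
carries a floor `B_P ≤ K₂`, and every `c ≥ −r − (κ − 2t′_A)B_A/4 − (2t′_P − κ)B_P/4` (`HubbardTTPrimeApexRowDoped` §4). At `n = 1`, `t′ < 0`:
`B_A = B_P = 0` is `StiffnessApexTransport` §5. [cite: KomaTasaki1994, §1] [cite: ScalapinoWhiteZhang1993, §II] -/
theorem ObsStiffnessSeqCeilingAt_on_apexRegion_of_fsumRow_of_le_diagHop (Uo : ℝ) (hUA : 0 ≤ UA) (hn0 : 0 ≤ n)
    (hn2 : n < 2) {u r : ℚ}
    (hrow : SquareTTPrimeCorrOrbitLowerRow t'A UA n u r Finset.univ (box 2 7) (-oddMomentObsTT t'A Uo 0))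
    (hu : energyDensityTT' 1 t'A UA n ≤ ((u : ℚ) : ℝ)) {BA : ℝ}
    (hBA : ∀ (ω : InfVolFermionState 2) (Ls : ℕ → ℕ) (ψ : ∀ L, Fock (Orb (FermionTorus 2 L))),
      Tendsto Ls atTop atTop →
      (∀ j, IsGroundStateInSector (hubbardTorusTT' (Ls j) 1 t'A UA) (rectN n (Ls j)) 0 (ψ (Ls j))) →
      (∀ j, star (ψ (Ls j)) ⬝ᵥ ψ (Ls j) = 1) → ω.IsTorusLimitOf ψ Ls →
      BA ≤ ω.meanEnergy (hubbardTTPrimeFermionInteraction 0 1 0) 1)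
    {t'P UP : ℝ} (hU : UA < UP) (h₁ : UA * t'P ≤ t'A * (2 * UA - UP)) (h₂ : t'A * UP ≤ t'P * (2 * UP - UA)) {BP : ℝ}
    (hBP : ∀ (ω : InfVolFermionState 2) (Ls : ℕ → ℕ) (ψ : ∀ L, Fock (Orb (FermionTorus 2 L))),
      Tendsto Ls atTop atTop →
      (∀ j, IsGroundStateInSector (hubbardTorusTT' (Ls j) 1 t'P UP) (rectN n (Ls j)) 0 (ψ (Ls j))) →
      (∀ j, star (ψ (Ls j)) ⬝ᵥ ψ (Ls j) = 1) → ω.IsTorusLimitOf ψ Ls →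
      BP ≤ ω.meanEnergy (hubbardTTPrimeFermionInteraction 0 1 0) 1)
    (c : ℚ) (hc : -((r : ℚ) : ℝ) - ((UP * t'A - UA * t'P) / (UP - UA) - 2 * t'A) * BA / 4 -
      (2 * t'P - (UP * t'A - UA * t'P) / (UP - UA)) * BP / 4 ≤ ((c : ℚ) : ℝ)) :
    ObsStiffnessSeqCeilingAt t'P UP n c := by
  intro ρs θ₀ _ hθ₀ Ls hLs hst
  refine fluxStiffness_le_of_torusLimitTT'_oddMoment_orbit_certificate_seq t'P (U := UP) (δ := 1 - n) (q := ((c : ℚ) : ℝ)) 0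
    Finset.univ Finset.univ_nonempty (by linarith) (by linarith) hθ₀ hLs hst ?_
  intro ω Ms ψ hMs hψ h1 hω
  have hψ' : ∀ j, IsGroundStateInSector (hubbardTorusTT' (Ms j) 1 t'P UP) (rectN n (Ms j)) 0 (ψ (Ms j)) := fun j => by
    simpa only [sub_sub_cancel] using hψ j
  rw [orbitMean_rotOddMomentLimitFunctionalTT_lam_zero_eq_meanEnergy_twice_tPrime hω.isTranslationInvariant]
  obtain ⟨ψA, φ, ωA, hφ, hψA, hψA1, hωA, -, -, -⟩ :=
    exists_isTorusLimitOf_sectorGroundState_TT' 1 t'A UA hn0 hn2.le (Ls := id) tendsto_id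
  have hLφ : Tendsto (id ∘ φ : ℕ → ℕ) atTop atTop := tendsto_id.comp hφ.tendsto_atTop
  have hchain := InfVolFermionState.IsTorusLimitOf.meanEnergy_twice_tPrime_source_add_le_of_groundStates_apexRegion 1 t'A t'P
    hUA hU h₁ h₂ hn0 hn2 hωA hLφ (fun j => hψA _) (fun j => hψA1 _) hω hMs hψ' h1
    (hBA ωA (id ∘ φ) ψA hLφ (fun j => hψA _) (fun j => hψA1 _) hωA) (hBP ω Ms ψ hMs hψ' h1 hω)
  have hv := hrow ωA (id ∘ φ) ψA hLφ (fun j => hψA _) (fun j => hψA1 _) hωA hu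
  rw [orbitMean_re_expect_neg_oddMomentTT_lam_zero hωA.isTranslationInvariant] at hv
  linarith

end Region

/-! ## §5 Arithmetic of the prices quoted in the header (pure `norm_num`; no number of record) -/

/-- Cuprate-box lever `(3/10)(1 − (15/2)/(17/2)) = 3/85` and the kinematic box price `0.8105695·(3/85) < 0.0286084`; along A0's apex
curve `(8, 7/8, −1/4) → (10, 7/8, −5/24)` the hypothesis-free reading `0.3603604 + 0.8105695·(−5/24 − (−1/4)) < 0.3941342 < 0.4008246`
(the companion's total-kinetic reading, `a0_apexCurve_points_and_kinetic_quarter`). [cite: LiebLoss1993, §8, Theorem 8.2] -/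
theorem dopedBox_levers_and_kinematic_prices :
    (-(-3 / 10 : ℝ)) * (1 - (15 / 2) / (17 / 2)) = 3 / 85 ∧ (0.8105695 : ℝ) * (3 / 85) < 0.0286084 ∧
      (0.3603604 : ℝ) + 0.8105695 * (-5 / 24 - (-1 / 4)) < 0.3941342 ∧ (0.3941342 : ℝ) < 0.4008246 := by
  refine ⟨?_, ?_, ?_, ?_⟩ <;> norm_num

end Summit.Ventures.CertifiedManyBodySolver.Observables

end
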